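import Mathlib
import Literature.NumberTheory.LFunctions.Zhang2022.Section7cStatements
import Literature.NumberTheory.LFunctions.Zhang2022.Section3MeanValues
import Literature.NumberTheory.LFunctions.Zhang2022.Section17MeanSquareMajorant
import HarnessLib

/-!
# Zhang (2022), slice L2-t4: the large-sieve display `§7.u039` for the `l`-polynomial, proved

Topic `Literature/NumberTheory/LFunctions/Zhang2022` (Landau–Siegel audit tree; verdict-neutral).
Companion of `Section7cStatements` (typed claims of Y. Zhang, arXiv:2211.02515v1, §7 pp. 37–39)
and `Section7cProofs`. This file PROVES the claim `Step7u039` (tex L2047, p.39):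

> For `σ = 1`, by the large sieve inequality we have
> `Σ_{R≤r<2R} Σ*_{θ mod r} |Σ_{l∈𝔌(Rh),(l,h)=1} (κ∗a₁)(dl)θ(l)l^{−s}|² ≪ τ₅(d)²𝓛^c(R² + PRht₀)(PRht₀)⁻¹ ≪ τ₅(d)²𝓛^c`

as typed (both bounds, under the ranges of (7.15)), with the explicit exponent `c = 225` and constant
`C = 57B²·majorantConst 25 10·524²⁵ + 2` (`B` the bound of (7.2)): `step7u039_holds`. Ingredients, all
from the tree: the large sieve for primitive characters over an arbitrary finite set of moduli
(`Zhang2022.largeSieve_meanValue`, moduli `R ≤ r < 2R ≤ ⌈2R⌉`, length `⌊4Pt₀Rh⌋`); the pointwise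
majorant `|(κ∗a₁)(dl)| ≤ Bτ₅(d)τ₅(l)` from `|κ| ≤ τ₄` (domination of the four convolution factors
`n^{−iβ₁}, n^{−iβ₂}, n^{−iβ₃}, μ`, `MeanSquareMajorant.dom_seqConv`) and the submultiplicativity
`τ_j(mn) ≤ τ_j(m)τ_j(n)` (proved here); the divisor count
`Σ_{l≤X} τ₅(l)²/l ≤ majorantConst 25 10 (log X)²⁵` (`MeanSquareMajorant.sum_tau_sq_div_le`); and
`log⌊4Pt₀Rh⌋ ≤ 524𝓛⁹` in the ranges of (7.15).

A second section uses the same majorant `|(κ∗a₁)(dl)| ≤ Bτ₅(d)τ₅(l)` for the small moduli: the step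
`§7.u034` ("Hence `𝔰(r,h,d;θ) ≪ τ₅(d)hrP²D^{−c}`", tex L2019) is proved as the EDGE
`step7u034_of : Step7bTruncP2 c′ → Eq714 c′ → Step7u033 c′ → Step7u034 c′` (split the `l`-series at
`P²`; the tail is the truncation claim, the head is (7.14) termwise, `Σ_{l≤P²} τ₅(l)/l ≪ 𝓛²²⁵`, and
§7.u033 with exponent `k + 225`). No definitions, no new named facts; nothing is asserted about
Theorems 1–2 of the manuscript or about Landau–Siegel zeros.

## References

* Y. Zhang, arXiv:2211.02515v1 (2022), §7 pp. 38–39, tex L2019, L2047.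
  [cite: Zhang2022LandauSiegel, §7 pp.38–39]
-/

noncomputable section

open Complex Real MeasureTheory
open Literature.NumberTheory.LFunctions.Zhang2022

namespace Literature.NumberTheory.LFunctions.Zhang2022.Section7cStatements

/-! ### `τ_j` is submultiplicative -/

/-- `τ_j(mn) ≤ τ_j(m)τ_j(n)` for all `m, n` (every divisor of `mn` is a product of a divisor of `m`
and a divisor of `n`). [folklore] -/
private theorem tau_mul_le (j m n : ℕ) :
    MeanSquareMajorant.tau j (m * n) ≤ MeanSquareMajorant.tau j m * MeanSquareMajorant.tau j n := by
  induction j generalizing m n with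
  | zero =>
    simp only [MeanSquareMajorant.tau_zero, ArithmeticFunction.one_apply, mul_eq_one]
    by_cases hm : m = 1
    · by_cases hn : n = 1
      · simp [hm, hn]
      · simp [hm, hn]
    · simp [hm]
  | succ j ih =>
    rcases Nat.eq_zero_or_pos m with rfl | hm
    · simp only [zero_mul, ArithmeticFunction.map_zero]
      exact le_of_eq (by ring)
    rcases Nat.eq_zero_or_pos n with rfl | hn
    · simp only [mul_zero, ArithmeticFunction.map_zero]
      exact le_of_eq (by ring)
    rw [MeanSquareMajorant.tau_succ_apply, MeanSquareMajorant.tau_succ_apply,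
      MeanSquareMajorant.tau_succ_apply, Finset.sum_mul_sum, ← Finset.sum_product']
    have hsub : (m * n).divisors ⊆ (m.divisors ×ˢ n.divisors).image (fun x => x.1 * x.2) := by
      intro e he
      have hd := Nat.dvd_of_mem_divisors he
      obtain ⟨e₁, e₂, h₁, h₂, rfl⟩ := Nat.dvd_mul.mp hd
      exact Finset.mem_image.mpr ⟨(e₁, e₂), Finset.mem_product.mpr
        ⟨Nat.mem_divisors.mpr ⟨h₁, hm.ne'⟩, Nat.mem_divisors.mpr ⟨h₂, hn.ne'⟩⟩, rfl⟩
    calc ∑ e ∈ (m * n).divisors, MeanSquareMajorant.tau j e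
        ≤ ∑ e ∈ (m.divisors ×ˢ n.divisors).image (fun x => x.1 * x.2), MeanSquareMajorant.tau j e :=
          Finset.sum_le_sum_of_subset_of_nonneg hsub fun _ _ _ => MeanSquareMajorant.tau_nonneg _ _
      _ ≤ ∑ x ∈ m.divisors ×ˢ n.divisors, MeanSquareMajorant.tau j (x.1 * x.2) :=
          Finset.sum_image_le_of_nonneg fun _ _ => MeanSquareMajorant.tau_nonneg _ _
      _ ≤ ∑ x ∈ m.divisors ×ˢ n.divisors, MeanSquareMajorant.tau j x.1 * MeanSquareMajorant.tau j x.2 :=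
          Finset.sum_le_sum fun x _ => ih x.1 x.2

/-! ### `|κ| ≤ τ₄` and `|κ ∗ a| ≤ B τ₅` -/

/-- Domination of a Dirichlet product of arithmetic functions from dominations of the factors
(the tree's `dom_seqConv`, rewritten through `ArithmeticFunction.mul_apply`). [folklore] -/
private theorem dom_mul {f g : ArithmeticFunction ℂ} {C₁ C₂ : ℝ} {g₁ g₂ : ArithmeticFunction ℝ}
    (hf : MeanSquareMajorant.Dom (fun n => f n) C₁ g₁) (hg : MeanSquareMajorant.Dom (fun n => g n) C₂ g₂) :
    MeanSquareMajorant.Dom (fun n => (f * g) n) (C₁ * C₂) (g₁ * g₂) := by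
  intro n hn
  have h := MeanSquareMajorant.dom_seqConv hf hg n hn
  rw [ArithmeticFunction.mul_apply]
  exact h

/-- `|κ(n)| ≤ τ₄(n)` for `n ≥ 1` (`κ = n^{−β₁} ∗ n^{−β₂} ∗ n^{−β₃} ∗ μ`, each factor bounded by `1`).
[folklore] -/
private theorem norm_kappaZ_le (c' : ℝ) (D : ℕ) {n : ℕ} (hn : n ≠ 0) :
    ‖Skeleton.kappaZ c' D n‖ ≤ MeanSquareMajorant.tau 4 n := by
  have hI : ∀ b : ℝ, MeanSquareMajorant.Dom (fun n => MeanSquareMajorant.powI b n) 1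
      (MeanSquareMajorant.tau 1) := fun b =>
    MeanSquareMajorant.dom_tau_one fun n hn =>
      (MeanSquareMajorant.norm_powI_of_pos b (Nat.pos_of_ne_zero hn)).le
  have hμ : MeanSquareMajorant.Dom
      (fun n => (ArithmeticFunction.moebius : ArithmeticFunction ℂ) n) 1 (MeanSquareMajorant.tau 1) :=
    MeanSquareMajorant.dom_tau_one fun n _ => norm_moebius_complex_le_one n
  have h := dom_mul (dom_mul (dom_mul (hI (Skeleton.b1 c' D)) (hI (Skeleton.b2 c' D)))
    (hI (Skeleton.b3 c' D))) hμ
  have h' := h n hn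
  have htau : MeanSquareMajorant.tau 1 * MeanSquareMajorant.tau 1 * MeanSquareMajorant.tau 1 *
      MeanSquareMajorant.tau 1 = MeanSquareMajorant.tau 4 := by
    simp only [MeanSquareMajorant.tau]; ring
  rw [htau] at h'
  unfold Skeleton.kappaZ MeanSquareMajorant.kappa
  simpa only [one_mul] using h'

/-- `|(κ ∗ a)(m)| ≤ B τ₅(m)` for `|a| ≤ B`. [folklore] -/
private theorem norm_conv_kappaZ_le (c' : ℝ) (D : ℕ) {a : ℕ → ℂ} {B : ℝ} (ha : ∀ n, ‖a n‖ ≤ B)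
    (m : ℕ) : ‖MeanSquareMajorant.conv (Skeleton.kappaZ c' D) a m‖ ≤ B * MeanSquareMajorant.tau 5 m := by
  rcases Nat.eq_zero_or_pos m with rfl | hm
  · simp [MeanSquareMajorant.conv]
  have hκ : MeanSquareMajorant.Dom (fun n => Skeleton.kappaZ c' D n) 1 (MeanSquareMajorant.tau 4) :=
    fun n hn => by rw [one_mul]; exact norm_kappaZ_le c' D hn
  have haD : MeanSquareMajorant.Dom a B (MeanSquareMajorant.tau 1) :=
    MeanSquareMajorant.dom_tau_one fun n _ => ha n
  have h := MeanSquareMajorant.dom_seqConv hκ haD m hm.ne'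
  have htau : MeanSquareMajorant.tau 4 * MeanSquareMajorant.tau 1 = MeanSquareMajorant.tau 5 := by
    simp only [MeanSquareMajorant.tau]; ring
  rw [htau, one_mul] at h
  exact h

/-! ### Elementary sizes -/

/-- `log D ≥ 1` once `D ≥ 3`. [folklore] -/
private theorem one_le_ell {D : ℕ} (hD : 3 ≤ D) : 1 ≤ Skeleton.ell D := by
  have hD' : (3 : ℝ) ≤ D := by exact_mod_cast hD
  rw [Skeleton.ell, Real.le_log_iff_exp_le (by linarith)]
  exact le_trans (le_of_lt (lt_trans Real.exp_one_lt_d9 (by norm_num))) hD'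

/-- `P = exp(𝓛⁹) ≥ 1`. [folklore] -/
private theorem one_le_bigP (D : ℕ) : 1 ≤ Skeleton.bigP D :=
  Real.one_le_exp (by rw [Skeleton.ell]; positivity)

/-- `P₁ = P^{0.504} ≤ P`. [folklore] -/
private theorem P1_le_bigP (D : ℕ) : Skeleton.P1 D ≤ Skeleton.bigP D := by
  have h := Real.rpow_le_rpow_of_exponent_le (one_le_bigP D) (show (0.504 : ℝ) ≤ 1 by norm_num)
  rwa [Real.rpow_one] at h

/-- `log⌊4PT₀Rh⌋ ≤ 524𝓛⁹` in the ranges of (7.15) (`Rh < P₁ = P^{0.504}`, `P = e^{𝓛⁹}`, `t₀ = 𝓛⁵¹⁹`).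
[folklore] -/
private theorem log_len_le {D : ℕ} (hD : 3 ≤ D) {R : ℝ} {h : ℕ} (hRh : R * h ≤ Skeleton.P1 D)
    {N : ℕ} (hN1 : 1 ≤ N)
    (hNle : (N : ℝ) ≤ 4 * Skeleton.bigP D * Skeleton.t0 D * (R * h)) :
    Real.log N ≤ 524 * Skeleton.ell D ^ 9 := by
  have hℓ1 := one_le_ell hD
  have hP1 := one_le_bigP D
  have hP0 : 0 < Skeleton.bigP D := by linarith
  have hT : Skeleton.t0 D = Skeleton.ell D ^ 519 := rfl
  have hT1 : 1 ≤ Skeleton.t0 D := by rw [hT]; exact one_le_pow₀ hℓ1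
  have hP1pos : 0 < Skeleton.P1 D := by rw [Skeleton.P1]; positivity
  have hN0 : (0 : ℝ) < N := by exact_mod_cast hN1
  have h4L : (N : ℝ) ≤ 4 * Skeleton.bigP D * Skeleton.t0 D * Skeleton.P1 D :=
    hNle.trans (by gcongr)
  have hlog4 : Real.log 4 ≤ 3 := by
    have := Real.log_le_sub_one_of_pos (show (0:ℝ) < 4 by norm_num); linarith
  have hlogP : Real.log (Skeleton.bigP D) = Skeleton.ell D ^ 9 := by
    rw [Skeleton.bigP, Real.log_exp]
  have hlogT : Real.log (Skeleton.t0 D) ≤ 519 * Skeleton.ell D := by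
    rw [hT, Real.log_pow]
    have := Real.log_le_sub_one_of_pos (show 0 < Skeleton.ell D by linarith)
    push_cast; nlinarith
  have hlogP1 : Real.log (Skeleton.P1 D) = 0.504 * Skeleton.ell D ^ 9 := by
    rw [Skeleton.P1, Real.log_rpow hP0, hlogP]
  have hℓ9 : Skeleton.ell D ≤ Skeleton.ell D ^ 9 := le_self_pow₀ hℓ1 (by norm_num)
  have h19 : 1 ≤ Skeleton.ell D ^ 9 := one_le_pow₀ hℓ1
  calc Real.log N ≤ Real.log (4 * Skeleton.bigP D * Skeleton.t0 D * Skeleton.P1 D) :=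
        Real.log_le_log hN0 h4L
    _ = Real.log 4 + Real.log (Skeleton.bigP D) + Real.log (Skeleton.t0 D) +
          Real.log (Skeleton.P1 D) := by
        rw [Real.log_mul (by positivity) hP1pos.ne', Real.log_mul (by positivity) (by positivity),
          Real.log_mul (by norm_num) hP0.ne']
    _ ≤ 3 + Skeleton.ell D ^ 9 + 519 * Skeleton.ell D + 0.504 * Skeleton.ell D ^ 9 := by
        rw [hlogP, hlogP1]; linarith
    _ ≤ 524 * Skeleton.ell D ^ 9 := by nlinarith

/-! ### The large-sieve display `§7.u039` -/

open scoped Classical in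
/-- **`§7.u039` holds**: for `σ = 1` and all real `t`, under the ranges of (7.15),
`Σ_{R≤r<2R} Σ*_{θ mod r} |Σ_{l∈𝔌(Rh),(l,h)=1} (κ∗a₁)(dl)θ(l)l^{−s}|² ≤ C τ₅(d)² 𝓛²²⁵ (R² + PRht₀)(PRht₀)⁻¹`
and `(R² + PRht₀)(PRht₀)⁻¹ ≤ C`, with `C = 57B²·majorantConst 25 10·524²⁵ + 2` — the tree's large
sieve `Zhang2022.largeSieve_meanValue` (moduli `R ≤ r < 2R ≤ ⌈2R⌉`, length `⌊4Pt₀Rh⌋`), the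
pointwise majorant `|(κ∗a₁)(dl)| ≤ Bτ₅(d)τ₅(l)` (`|κ| ≤ τ₄`, `τ₅(dl) ≤ τ₅(d)τ₅(l)`), and the
divisor count `Σ_{l≤X} τ₅(l)²/l ≤ majorantConst 25 10 (log X)²⁵` (`MeanSquareMajorant.sum_tau_sq_div_le`).
[cite: Zhang2022LandauSiegel, §7 p.39, tex L2047] -/
theorem step7u039_holds (c' : ℝ) : Step7u039 c' := by
  intro B
  set K := MeanSquareMajorant.majorantConst 25 10 with hK
  have hK0 : 0 < K := MeanSquareMajorant.majorantConst_pos _ _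
  refine ⟨225, 57 * B ^ 2 * K * 524 ^ 25 + 2, 3, fun D _ χ hD _ _ _ a₁ ha₁ d h R hd hh hR t => ?_⟩
  obtain ⟨hdh, hRD, hRP⟩ := hR
  have hD3 : 3 ≤ D := hD
  -- the quantities
  set P := Skeleton.bigP D with hPdef
  set ℓ := Skeleton.ell D with hℓ
  set T₀ := Skeleton.t0 D with hT₀
  set L := P * R * (h : ℝ) * T₀ with hLdef
  set τd := MeanSquareMajorant.tau 5 d with hτd
  have hP1 : 1 ≤ P := one_le_bigP D
  have hℓ1 : 1 ≤ ℓ := one_le_ell hD3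
  have hT1 : 1 ≤ T₀ := by rw [hT₀, Skeleton.t0]; exact one_le_pow₀ hℓ1
  have hD1 : (1 : ℝ) ≤ D := by exact_mod_cast (show 1 ≤ D by omega)
  have hR1 : 1 ≤ R := le_trans (by exact_mod_cast (show 1 ≤ D by omega)) hRD
  have hR0 : 0 ≤ R := by linarith
  have hh1 : (1 : ℝ) ≤ h := by exact_mod_cast hh
  have hL1 : 1 ≤ L := by
    have h1 : (1 : ℝ) ≤ P * R := one_le_mul_of_one_le_of_one_le hP1 hR1
    have h2 : (1 : ℝ) ≤ P * R * h := one_le_mul_of_one_le_of_one_le h1 hh1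
    exact one_le_mul_of_one_le_of_one_le h2 hT1
  have hL0 : 0 < L := by linarith
  have hB0 : 0 ≤ B := (norm_nonneg _).trans (ha₁.1 0)
  -- `R h ≤ P₁ ≤ P`
  have hRh : R * h ≤ Skeleton.P1 D := by
    have hdh0 : (0 : ℝ) < ((d * h : ℕ) : ℝ) := by
      have : 0 < d * h := Nat.mul_pos hd hh
      exact_mod_cast this
    have h1 : R * ((d * h : ℕ) : ℝ) < Skeleton.P1 D := (lt_div_iff₀ hdh0).mp hRP
    have hd1 : (1 : ℝ) ≤ d := by exact_mod_cast hd
    have h2 : R * h ≤ R * ((d * h : ℕ) : ℝ) := by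
      apply mul_le_mul_of_nonneg_left _ hR0
      push_cast
      nlinarith
    linarith
  have hRP' : R ≤ P := by
    have : R ≤ R * h := le_mul_of_one_le_right hR0 hh1
    exact this.trans (hRh.trans (P1_le_bigP D))
  -- the large sieve data
  set S := (natI D (R * h)).filter (fun l => Nat.Coprime l h) with hS
  set N : ℕ := ⌊4 * Skeleton.bigP D * Skeleton.t0 D * (R * h)⌋₊ with hN
  set Q : ℕ := ⌈2 * R⌉₊ with hQ
  set s : ℂ := 1 + t * I with hs
  set b : ℕ → ℂ := fun l =>
    if l ∈ S then MeanSquareMajorant.conv (Skeleton.kappaZ c' D) a₁ (d * l) * (l : ℂ) ^ (-s) else 0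
    with hb
  have hSsub : S ⊆ Finset.Ioc 0 N := by
    intro l hl
    have hl2 := Finset.mem_filter.mp (Finset.mem_filter.mp hl).1
    refine Finset.mem_Ioc.mpr ⟨hl2.2.1, ?_⟩
    have := Finset.mem_range.mp hl2.1
    omega
  have hM : dyadic R ⊆ Finset.Icc 1 Q := by
    intro r hr
    obtain ⟨hRr, _⟩ := (Finset.mem_filter.mp hr).2
    have h1 : (1 : ℝ) ≤ r := le_trans hR1 hRr
    have hrQ : r < Q := Finset.mem_range.mp (Finset.mem_filter.mp hr).1
    exact Finset.mem_Icc.mpr ⟨by exact_mod_cast h1, hrQ.le⟩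
  have hLS := largeSieve_meanValue (dyadic R) N Q hM b
  -- the left side is the large-sieve form
  have hlhs : (∑ r ∈ dyadic R, ∑ θ : DirichletCharacter ℂ r,
        (if θ.IsPrimitive then ‖lPoly c' D a₁ R r h d θ s‖ ^ 2 else 0)) =
      ∑ r ∈ dyadic R, ∑ θ : DirichletCharacter ℂ r with θ.IsPrimitive,
        ‖∑ n ∈ Finset.Ioc 0 N, b n * θ n‖ ^ 2 := by
    refine Finset.sum_congr rfl fun r _ => ?_
    rw [Finset.sum_filter]
    refine Finset.sum_congr rfl fun θ _ => ?_
    split_ifs with hθ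
    · congr 2
      rw [lPoly]
      have hsum : ∑ n ∈ Finset.Ioc 0 N, b n * θ n =
          ∑ n ∈ Finset.Ioc 0 N, (if n ∈ S then
            MeanSquareMajorant.conv (Skeleton.kappaZ c' D) a₁ (d * n) * (n : ℂ) ^ (-s) * θ n
            else 0) := by
        refine Finset.sum_congr rfl fun n _ => ?_
        simp only [hb]
        split_ifs <;> simp
      rw [hsum, Finset.sum_ite_mem, Finset.inter_eq_right.mpr hSsub]
      exact Finset.sum_congr rfl fun l _ => by ring
    · rfl
  -- the coefficients: `‖b(n)‖² ≤ B²τ₅(d)²(3/L)·τ₅(n)²/n` on `S`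
  have hcoef : ∀ n ∈ S, ‖b n‖ ^ 2 ≤ B ^ 2 * τd ^ 2 * (3 / L) * (MeanSquareMajorant.tau 5 n ^ 2 / n) := by
    intro n hn
    have hnI := (Finset.mem_filter.mp (Finset.mem_filter.mp hn).1).2
    have hn0 : 0 < n := hnI.1
    have hn' : (0 : ℝ) < n := by exact_mod_cast hn0
    have hnL : L ≤ 3 * n := by
      have h1 : 1 / 3 * Skeleton.bigP D * Skeleton.t0 D * (R * h) ≤ n := hnI.2.1
      have : L = 3 * (1 / 3 * Skeleton.bigP D * Skeleton.t0 D * (R * h)) := by rw [hLdef]; ring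
      linarith
    simp only [hb, if_pos hn]
    rw [norm_mul, mul_pow, Complex.norm_natCast_cpow_of_pos hn0]
    have hre : (-s).re = -1 := by simp [hs]
    rw [hre, Real.rpow_neg_one]
    have h1 : ‖MeanSquareMajorant.conv (Skeleton.kappaZ c' D) a₁ (d * n)‖ ≤
        B * (τd * MeanSquareMajorant.tau 5 n) :=
      (norm_conv_kappaZ_le c' D ha₁.1 (d * n)).trans
        (mul_le_mul_of_nonneg_left (tau_mul_le 5 d n) hB0)
    have h2 : ‖MeanSquareMajorant.conv (Skeleton.kappaZ c' D) a₁ (d * n)‖ ^ 2 ≤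
        (B * (τd * MeanSquareMajorant.tau 5 n)) ^ 2 := pow_le_pow_left₀ (norm_nonneg _) h1 2
    have h3 : ((n : ℝ)⁻¹) ^ 2 ≤ (3 / L) * (1 / n) := by
      rw [inv_pow, ← one_div, div_mul_div_comm, mul_one, div_le_div_iff₀ (by positivity) (by positivity)]
      nlinarith
    calc ‖MeanSquareMajorant.conv (Skeleton.kappaZ c' D) a₁ (d * n)‖ ^ 2 * ((n : ℝ)⁻¹) ^ 2
        ≤ (B * (τd * MeanSquareMajorant.tau 5 n)) ^ 2 * ((3 / L) * (1 / n)) :=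
          mul_le_mul h2 h3 (by positivity) (by positivity)
      _ = B ^ 2 * τd ^ 2 * (3 / L) * (MeanSquareMajorant.tau 5 n ^ 2 / n) := by ring
  -- the coefficient sum
  have hN2 : 2 ≤ N := by
    rw [hN]
    apply Nat.le_floor
    push_cast
    have : (1:ℝ) ≤ R * h := one_le_mul_of_one_le_of_one_le hR1 hh1
    nlinarith [hP1, hT1, this]
  have hN1 : (1 : ℝ) ≤ N := by exact_mod_cast le_trans (by norm_num) hN2
  have hsumb : ∑ n ∈ Finset.Ioc 0 N, ‖b n‖ ^ 2 ≤
      B ^ 2 * τd ^ 2 * (3 / L) * (K * Real.log N ^ 25) := by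
    have hzero : ∀ n ∈ Finset.Ioc 0 N, n ∉ S → ‖b n‖ ^ 2 = 0 := fun n _ hn => by simp [hb, hn]
    have htauSum : ∑ n ∈ Finset.Icc 1 N, MeanSquareMajorant.tau 5 n ^ 2 / n ≤ K * Real.log N ^ 25 := by
      have := MeanSquareMajorant.sum_tau_sq_div_le 5 hN2
      norm_num at this
      rw [hK]; exact this
    calc ∑ n ∈ Finset.Ioc 0 N, ‖b n‖ ^ 2 = ∑ n ∈ S, ‖b n‖ ^ 2 :=
          (Finset.sum_subset hSsub hzero).symm
      _ ≤ ∑ n ∈ S, B ^ 2 * τd ^ 2 * (3 / L) * (MeanSquareMajorant.tau 5 n ^ 2 / n) :=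
          Finset.sum_le_sum hcoef
      _ = B ^ 2 * τd ^ 2 * (3 / L) * ∑ n ∈ S, MeanSquareMajorant.tau 5 n ^ 2 / n := by
          rw [Finset.mul_sum]
      _ ≤ B ^ 2 * τd ^ 2 * (3 / L) * ∑ n ∈ Finset.Icc 1 N, MeanSquareMajorant.tau 5 n ^ 2 / n := by
          apply mul_le_mul_of_nonneg_left _ (by positivity)
          apply Finset.sum_le_sum_of_subset_of_nonneg
          · intro n hn
            have := Finset.mem_Ioc.mp (hSsub hn)
            exact Finset.mem_Icc.mpr ⟨this.1, this.2⟩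
          · intro n _ _
            exact div_nonneg (sq_nonneg _) (Nat.cast_nonneg _)
      _ ≤ B ^ 2 * τd ^ 2 * (3 / L) * (K * Real.log N ^ 25) :=
          mul_le_mul_of_nonneg_left htauSum (by positivity)
  -- sizes of `N`, `Q`, `log N`
  have hNle : (N : ℝ) ≤ 4 * Skeleton.bigP D * Skeleton.t0 D * (R * h) := Nat.floor_le (by positivity)
  have hNL : (N : ℝ) ≤ 4 * L := by rw [hLdef]; linarith [hNle]
  have hQle : (Q : ℝ) ≤ 3 * R := by
    calc (Q : ℝ) ≤ 2 * R + 1 := (Nat.ceil_lt_add_one (by linarith)).le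
      _ ≤ 3 * R := by linarith
  have hQsq : (Q : ℝ) ^ 2 ≤ (3 * R) ^ 2 := by gcongr
  have hfac : (N : ℝ) + 1 + 2 * (Q : ℝ) ^ 2 ≤ 19 * (R ^ 2 + L) := by nlinarith
  have hlogN : Real.log N ≤ 524 * ℓ ^ 9 := log_len_le hD3 hRh (by exact_mod_cast le_trans (by norm_num) hN2) hNle
  have hlog25 : Real.log N ^ 25 ≤ 524 ^ 25 * ℓ ^ 225 := by
    calc Real.log N ^ 25 ≤ (524 * ℓ ^ 9) ^ 25 :=
          pow_le_pow_left₀ (Real.log_nonneg hN1) hlogN 25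
      _ = 524 ^ 25 * ℓ ^ 225 := by ring
  -- assemble, with the numerical constant `524²⁵` kept opaque
  set A : ℝ := 524 ^ 25 with hA
  have hA0 : 0 < A := by rw [hA]; positivity
  have hX0 : 0 ≤ τd ^ 2 * ℓ ^ 225 * ((R ^ 2 + L) / L) := by positivity
  refine ⟨?_, ?_⟩
  · have step1 : (∑ r ∈ dyadic R, ∑ θ : DirichletCharacter ℂ r,
          (if θ.IsPrimitive then ‖lPoly c' D a₁ R r h d θ s‖ ^ 2 else 0)) ≤
        (19 * (R ^ 2 + L)) * (B ^ 2 * τd ^ 2 * (3 / L) * (K * (A * ℓ ^ 225))) := by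
      calc (∑ r ∈ dyadic R, ∑ θ : DirichletCharacter ℂ r,
            (if θ.IsPrimitive then ‖lPoly c' D a₁ R r h d θ s‖ ^ 2 else 0))
          = ∑ r ∈ dyadic R, ∑ θ : DirichletCharacter ℂ r with θ.IsPrimitive,
              ‖∑ n ∈ Finset.Ioc 0 N, b n * θ n‖ ^ 2 := hlhs
        _ ≤ ((N : ℝ) + 1 + 2 * (Q : ℝ) ^ 2) * ∑ n ∈ Finset.Ioc 0 N, ‖b n‖ ^ 2 := hLS
        _ ≤ (19 * (R ^ 2 + L)) * (B ^ 2 * τd ^ 2 * (3 / L) * (K * Real.log N ^ 25)) :=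
            mul_le_mul hfac hsumb (Finset.sum_nonneg fun _ _ => by positivity) (by positivity)
        _ ≤ (19 * (R ^ 2 + L)) * (B ^ 2 * τd ^ 2 * (3 / L) * (K * (A * ℓ ^ 225))) := by
            apply mul_le_mul_of_nonneg_left _ (by positivity)
            apply mul_le_mul_of_nonneg_left _ (by positivity)
            exact mul_le_mul_of_nonneg_left hlog25 hK0.le
    have step2 : (19 * (R ^ 2 + L)) * (B ^ 2 * τd ^ 2 * (3 / L) * (K * (A * ℓ ^ 225))) =
        (57 * B ^ 2 * K * A) * (τd ^ 2 * ℓ ^ 225 * ((R ^ 2 + L) / L)) := by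
      rw [div_eq_mul_inv, div_eq_mul_inv]
      ring
    have step3 : (57 * B ^ 2 * K * A) * (τd ^ 2 * ℓ ^ 225 * ((R ^ 2 + L) / L)) ≤
        (57 * B ^ 2 * K * A + 2) * (τd ^ 2 * ℓ ^ 225 * ((R ^ 2 + L) / L)) :=
      mul_le_mul_of_nonneg_right (by linarith only []) hX0
    calc (∑ r ∈ dyadic R, ∑ θ : DirichletCharacter ℂ r,
          (if θ.IsPrimitive then ‖lPoly c' D a₁ R r h d θ s‖ ^ 2 else 0))
        ≤ _ := step1
      _ = _ := step2
      _ ≤ _ := step3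
      _ = (57 * B ^ 2 * K * A + 2) * τd ^ 2 * ℓ ^ 225 * ((R ^ 2 + L) / L) := by ring
  · have hRL : R ^ 2 ≤ L := by
      have h1 : R ≤ P * (h : ℝ) * T₀ := by
        calc R ≤ P := hRP'
          _ ≤ P * h := le_mul_of_one_le_right (by linarith only [hP1]) hh1
          _ ≤ P * h * T₀ := le_mul_of_one_le_right (by positivity) hT1
      calc R ^ 2 = R * R := sq R
        _ ≤ (P * h * T₀) * R := mul_le_mul_of_nonneg_right h1 hR0
        _ = L := by rw [hLdef]; ring
    have h2 : (R ^ 2 + L) / L ≤ 2 := by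
      rw [div_le_iff₀ hL0]; linarith only [hRL]
    have h3 : (2 : ℝ) ≤ 57 * B ^ 2 * K * A + 2 := by
      have : 0 ≤ 57 * B ^ 2 * K * A := by positivity
      linarith only [this]
    exact h2.trans h3

/-! ### `§7.u034` as an edge: the `l > P²` truncation, (7.14) and `§7.u033` -/

/-- `τ₅(l) ≥ 1` for `l ≥ 1` (there is at least the trivial factorisation). [folklore] -/
private theorem one_le_tau_five' {l : ℕ} (hl : l ≠ 0) : 1 ≤ MeanSquareMajorant.tau 5 l := by
  have key : ∀ j : ℕ, 1 ≤ MeanSquareMajorant.tau (j + 1) l := by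
    intro j
    induction j with
    | zero => rw [MeanSquareMajorant.tau_one_apply hl]
    | succ j ih =>
      rw [MeanSquareMajorant.tau_succ_apply]
      calc (1 : ℝ) ≤ MeanSquareMajorant.tau (j + 1) l := ih
        _ ≤ ∑ e ∈ l.divisors, MeanSquareMajorant.tau (j + 1) e :=
          Finset.single_le_sum (f := fun e => MeanSquareMajorant.tau (j + 1) e)
            (fun e _ => MeanSquareMajorant.tau_nonneg (j + 1) e) (Nat.mem_divisors_self l hl)
  exact key 4

/-- `Σ_{1≤l≤N} τ₅(l)/l ≤ majorantConst 25 10 · (log N)²⁵` for `N ≥ 2` (from the tree's count of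
`Σ τ₅(l)²/l`, `MeanSquareMajorant.sum_tau_sq_div_le`, and `τ₅ ≤ τ₅²`). [folklore] -/
private theorem sum_tau_five_div_le {N : ℕ} (hN : 2 ≤ N) :
    ∑ l ∈ Finset.Icc 1 N, MeanSquareMajorant.tau 5 l / l ≤
      MeanSquareMajorant.majorantConst 25 10 * Real.log N ^ 25 := by
  have h := MeanSquareMajorant.sum_tau_sq_div_le 5 hN
  norm_num at h
  refine le_trans (Finset.sum_le_sum fun l hl => ?_) h
  have hl1 : 1 ≤ l := (Finset.mem_Icc.1 hl).1
  have h1 : 1 ≤ MeanSquareMajorant.tau 5 l := one_le_tau_five' (by omega)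
  exact div_le_div_of_nonneg_right (le_self_pow₀ h1 two_ne_zero) (Nat.cast_nonneg l)

/-- `Z22:§7.u034` as an EDGE: "Hence `𝔰(r,h,d;θ) ≪ τ₅(d)hrP²D^{−c}`" (for `1 < r < D`, `θ` primitive,
`(d,h,r)` in the range of `Σ′`) FOLLOWS from the `l > P²` truncation `Step7bTruncP2`, the Mellin bound
(7.14) `Eq714` and the Lemma 5.6 step `Step7u033`: split the `l`-series `𝔰` at `P²` (if it does not
converge, `𝔰 = 0` by convention and there is nothing to prove); the tail is `≤ exp(−c𝓛¹⁰) ≤ D^{−c}`;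
for `l ≤ P²`, `|(κ∗a₁)(dl)| ≤ Bτ₅(d)τ₅(l)`, (7.14) and `Σ_{l≤P²} τ₅(l)/l ≪ 𝓛²²⁵` leave
`τ₅(d)·hr·𝓛^{k+225}∫|Σ_p θ̄(p)p^{1+it+β₃}|dt/(1+t²)`, which `Step7u033` (with exponent `k + 225`, at
`l = 1`) bounds by `τ₅(d)hrP²D^{−c}`. [cite: Zhang2022LandauSiegel, §7 p.38, tex L2019] -/
theorem step7u034_of (c' : ℝ) (hT : Step7bTruncP2 c') (h14 : Eq714 c') (h33 : Step7u033 c') :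
    Step7u034 c' := by
  intro B
  obtain ⟨cT, hcT, DT, hT⟩ := hT B
  obtain ⟨k₁, C₁, D₁, h14⟩ := h14
  obtain ⟨c₃, hc₃, C₃, D₃, h33⟩ := h33 (k₁ + 225)
  set K := MeanSquareMajorant.majorantConst 25 10 with hK
  have hK0 : 0 < K := MeanSquareMajorant.majorantConst_pos _ _
  refine ⟨min cT c₃, lt_min hcT hc₃, max B 0 * max C₁ 0 * K * 2 ^ 25 * max C₃ 0 + 1,
    max (max DT D₁) (max D₃ 3), fun D _ χ hD hq hp hA a₁ ha d h r θ hx hrD hθ => ?_⟩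
  have hDT : DT ≤ D := le_trans (le_trans (le_max_left _ _) (le_max_left _ _)) hD
  have hD₁ : D₁ ≤ D := le_trans (le_trans (le_max_right _ _) (le_max_left _ _)) hD
  have hD₃ : D₃ ≤ D := le_trans (le_trans (le_max_left _ _) (le_max_right _ _)) hD
  have hD3 : 3 ≤ D := le_trans (le_trans (le_max_right _ _) (le_max_right _ _)) hD
  -- the triple `(d, h, r)`: `d, h ≥ 1`, `r ≥ 2`
  have hx' := hx
  simp only [tripleSet, Finset.mem_filter, Finset.mem_product, Finset.mem_Ico] at hx'
  obtain ⟨⟨⟨hd1, -⟩, ⟨hh1, -⟩, ⟨hr2, -⟩⟩, -⟩ := hx'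
  have hd : 0 < d := hd1
  have hh : 0 < h := hh1
  have h1r : 1 < r := hr2
  have hr : 0 < r := by omega
  -- the three inputs
  have HT := hT D χ hDT hq hp hA a₁ ha d h r θ hx hθ
  have H14 := h14 D χ hD₁ hq hp hA
  have H33 := h33 D χ hD₃ hq hp hA r h 1 θ h1r hrD hθ hh one_pos
  simp only [Nat.cast_one, div_one] at H33
  -- sizes
  have hL1 : 1 ≤ Skeleton.ell D := one_le_ell hD3
  have hP1 : 1 ≤ Skeleton.bigP D := one_le_bigP D
  set L := Skeleton.ell D with hLdef
  set P := Skeleton.bigP D with hPdef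
  set τ := MeanSquareMajorant.tau 5 d with hτdef
  have hL0 : 0 ≤ L := zero_le_one.trans hL1
  have hD0 : (0 : ℝ) < D := by exact_mod_cast (show 0 < D by omega)
  have hD1 : (1 : ℝ) ≤ D := by exact_mod_cast (show 1 ≤ D by omega)
  have hlogD : Real.log (D : ℝ) = L := by rw [hLdef, Skeleton.ell]
  have hτ1 : 1 ≤ τ := one_le_tau_five' (by omega)
  have hτ0 : 0 ≤ τ := zero_le_one.trans hτ1
  have hhr1 : (1 : ℝ) ≤ ((h * r : ℕ) : ℝ) := by exact_mod_cast Nat.mul_pos hh hr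
  have hB0 : 0 ≤ B := le_trans (norm_nonneg _) (ha.1 0)
  set I₀ : ℝ := ∫ t : ℝ, ‖pPoly D r θ (1 + t * I + Skeleton.beta3 c' D)‖ / (1 + t ^ 2) with hI₀def
  have hI0 : 0 ≤ I₀ := integral_nonneg fun t => by positivity
  -- the target is nonnegative
  have hDc : 0 < (D : ℝ) ^ (-min cT c₃) := Real.rpow_pos_of_pos hD0 _
  have hRHS0 : 0 ≤ (max B 0 * max C₁ 0 * K * 2 ^ 25 * max C₃ 0 + 1) * τ * ((h * r : ℕ) : ℝ) *
      P ^ 2 * (D : ℝ) ^ (-min cT c₃) := by positivity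
  -- the summands of `𝔰` and of its tail
  set S : ℕ → ℂ := fun l => ∑ p ∈ Skeleton.primeWindow D,
      (p : ℂ) ^ Skeleton.beta3 c' D * θ⁻¹ (p : ZMod r) *
        Skeleton.DeltaW D ((l : ℝ) / ((p : ℝ) * h * r)) with hSdef
  set f : ℕ → ℂ := fun l => if Nat.Coprime l h then
      MeanSquareMajorant.conv (Skeleton.kappaZ c' D) a₁ (d * l) * θ (l : ZMod r) * S l else 0
    with hfdef
  set tl : ℕ → ℂ := fun l => if P ^ 2 < (l : ℝ) ∧ Nat.Coprime l h then
      MeanSquareMajorant.conv (Skeleton.kappaZ c' D) a₁ (d * l) * θ (l : ZMod r) * S l else 0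
    with htldef
  have hfrakS : frakS c' D a₁ r h d θ = ∑' l, f l := rfl
  have htail : tail7P2 c' D a₁ r h d θ = ∑' l, tl l := rfl
  by_cases hsum : Summable f
  swap
  · rw [hfrakS, tsum_eq_zero_of_not_summable hsum, norm_zero]; exact hRHS0
  -- split `f = g + tl`, `g` supported on `l ≤ N = ⌊P²⌋`
  set N := ⌊P ^ 2⌋₊ with hNdef
  set g : ℕ → ℂ := fun l => f l - tl l with hgdef
  have hg_zero : ∀ l ∉ Finset.range (N + 1), g l = 0 := by
    intro l hl
    have hlN : N + 1 ≤ l := by simpa [Finset.mem_range, not_lt] using hl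
    have hlP : P ^ 2 < (l : ℝ) := Nat.lt_of_floor_lt (by omega)
    simp only [hgdef, hfdef, htldef, hlP, true_and, sub_self]
  have hg_sum : Summable g := summable_of_ne_finset_zero hg_zero
  have htl_sum : Summable tl := by
    refine (hsum.sub hg_sum).congr fun l => ?_
    simp only [hgdef]; ring
  have hsplit : frakS c' D a₁ r h d θ =
      ∑ l ∈ Finset.range (N + 1), g l + tail7P2 c' D a₁ r h d θ := by
    rw [hfrakS, htail]
    have e1 : ∑' l, f l = ∑' l, (g l + tl l) := tsum_congr fun l => by simp only [hgdef]; ring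
    rw [e1, hg_sum.tsum_add htl_sum, tsum_eq_sum hg_zero]
  have hg_eq : ∀ l ∈ Finset.range (N + 1), g l = f l := by
    intro l hl
    have hlN : l ≤ N := by simpa [Finset.mem_range, Nat.lt_succ_iff] using hl
    have hlP : ¬ (P ^ 2 < (l : ℝ)) :=
      not_lt.2 (le_trans (by exact_mod_cast hlN) (Nat.floor_le (by positivity)))
    simp only [hgdef, htldef, hlP, false_and, if_false, sub_zero]
  -- the bound for a single `l ≤ P²`
  have hf_bound : ∀ l ∈ Finset.range (N + 1), ‖f l‖ ≤
      max B 0 * max C₁ 0 * τ * L ^ k₁ * ((h * r : ℕ) : ℝ) * I₀ *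
        (MeanSquareMajorant.tau 5 l / l) := by
    intro l hl
    rcases Nat.eq_zero_or_pos l with rfl | hl0
    · simp [hfdef, MeanSquareMajorant.conv]
    have hlN : l ≤ N := by simpa [Finset.mem_range, Nat.lt_succ_iff] using hl
    have hlP : (l : ℝ) ≤ P ^ 2 := le_trans (by exact_mod_cast hlN) (Nat.floor_le (by positivity))
    have hS : ‖S l‖ ≤ C₁ * L ^ k₁ * (((h * r : ℕ) : ℝ) / l) * I₀ := H14 r h l θ hr hh hl0 hlP
    have hS' : ‖S l‖ ≤ max C₁ 0 * L ^ k₁ * (((h * r : ℕ) : ℝ) / l) * I₀ :=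
      hS.trans (mul_le_mul_of_nonneg_right (mul_le_mul_of_nonneg_right
        (mul_le_mul_of_nonneg_right (le_max_left _ _) (pow_nonneg hL0 _)) (by positivity)) hI0)
    have hconv : ‖MeanSquareMajorant.conv (Skeleton.kappaZ c' D) a₁ (d * l)‖ ≤
        max B 0 * (τ * MeanSquareMajorant.tau 5 l) := by
      calc ‖MeanSquareMajorant.conv (Skeleton.kappaZ c' D) a₁ (d * l)‖
          ≤ B * MeanSquareMajorant.tau 5 (d * l) := norm_conv_kappaZ_le c' D ha.1 (d * l)
        _ ≤ max B 0 * MeanSquareMajorant.tau 5 (d * l) :=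
            mul_le_mul_of_nonneg_right (le_max_left _ _) (MeanSquareMajorant.tau_nonneg _ _)
        _ ≤ max B 0 * (τ * MeanSquareMajorant.tau 5 l) :=
            mul_le_mul_of_nonneg_left (tau_mul_le 5 d l) (le_max_right _ _)
    have hθl : ‖θ (l : ZMod r)‖ ≤ 1 := DirichletCharacter.norm_le_one _ _
    have hτl : 0 ≤ MeanSquareMajorant.tau 5 l := MeanSquareMajorant.tau_nonneg _ _
    have hfl : ‖f l‖ ≤ ‖MeanSquareMajorant.conv (Skeleton.kappaZ c' D) a₁ (d * l)‖ * 1 * ‖S l‖ := by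
      simp only [hfdef]
      split_ifs with hc
      · rw [norm_mul, norm_mul]; gcongr
      · rw [norm_zero]; positivity
    calc ‖f l‖ ≤ ‖MeanSquareMajorant.conv (Skeleton.kappaZ c' D) a₁ (d * l)‖ * 1 * ‖S l‖ := hfl
      _ ≤ max B 0 * (τ * MeanSquareMajorant.tau 5 l) * 1 *
            (max C₁ 0 * L ^ k₁ * (((h * r : ℕ) : ℝ) / l) * I₀) :=
          mul_le_mul (mul_le_mul_of_nonneg_right hconv zero_le_one) hS' (norm_nonneg _)
            (by positivity)
      _ = max B 0 * max C₁ 0 * τ * L ^ k₁ * ((h * r : ℕ) : ℝ) * I₀ *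
            (MeanSquareMajorant.tau 5 l / l) := by ring
  -- summing over `l ≤ P²`
  have hN2 : 2 ≤ N := by
    have hPe : Real.exp 1 ≤ P := by
      rw [show P = Real.exp (L ^ 9) from rfl]; exact Real.exp_le_exp.2 (one_le_pow₀ hL1)
    have he : (2 : ℝ) < Real.exp 1 := by have := Real.exp_one_gt_d9; linarith
    have h2 : (2 : ℝ) ≤ P ^ 2 := by nlinarith
    exact Nat.le_floor (by exact_mod_cast h2)
  have hlogN : Real.log N ≤ 2 * L ^ 9 := by
    have hN0 : (0 : ℝ) < N := by exact_mod_cast (show 0 < N by omega)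
    have hNP : (N : ℝ) ≤ P ^ 2 := Nat.floor_le (by positivity)
    calc Real.log N ≤ Real.log (P ^ 2) := Real.log_le_log hN0 hNP
      _ = 2 * L ^ 9 := by
          rw [Real.log_pow, show P = Real.exp (L ^ 9) from rfl, Real.log_exp]; ring
  have hlogN0 : 0 ≤ Real.log N := Real.log_natCast_nonneg N
  have htauSum : ∑ l ∈ Finset.Icc 1 N, MeanSquareMajorant.tau 5 l / l ≤ K * 2 ^ 25 * L ^ 225 := by
    calc ∑ l ∈ Finset.Icc 1 N, MeanSquareMajorant.tau 5 l / l ≤ K * Real.log N ^ 25 := by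
          rw [hK]; exact sum_tau_five_div_le hN2
      _ ≤ K * (2 * L ^ 9) ^ 25 := by gcongr
      _ = K * 2 ^ 25 * L ^ 225 := by ring
  have hcoef0 : 0 ≤ max B 0 * max C₁ 0 * τ * L ^ k₁ * ((h * r : ℕ) : ℝ) * I₀ := by positivity
  have hsum_g : ‖∑ l ∈ Finset.range (N + 1), g l‖ ≤
      max B 0 * max C₁ 0 * τ * L ^ k₁ * ((h * r : ℕ) : ℝ) * I₀ * (K * 2 ^ 25 * L ^ 225) := by
    have hIcc : ∑ l ∈ Finset.Icc 1 N, MeanSquareMajorant.tau 5 l / (l : ℝ) =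
        ∑ l ∈ Finset.range (N + 1), MeanSquareMajorant.tau 5 l / (l : ℝ) := by
      apply Finset.sum_subset
      · intro x hx
        rw [Finset.mem_Icc] at hx; rw [Finset.mem_range]; omega
      · intro x hx hx'
        rw [Finset.mem_range] at hx; rw [Finset.mem_Icc] at hx'
        have : x = 0 := by omega
        subst this; simp
    calc ‖∑ l ∈ Finset.range (N + 1), g l‖ ≤ ∑ l ∈ Finset.range (N + 1), ‖g l‖ := norm_sum_le _ _
      _ = ∑ l ∈ Finset.range (N + 1), ‖f l‖ :=
          Finset.sum_congr rfl fun l hl => by rw [hg_eq l hl]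
      _ ≤ ∑ l ∈ Finset.range (N + 1), max B 0 * max C₁ 0 * τ * L ^ k₁ * ((h * r : ℕ) : ℝ) * I₀ *
            (MeanSquareMajorant.tau 5 l / l) := Finset.sum_le_sum hf_bound
      _ = max B 0 * max C₁ 0 * τ * L ^ k₁ * ((h * r : ℕ) : ℝ) * I₀ *
            ∑ l ∈ Finset.Icc 1 N, MeanSquareMajorant.tau 5 l / (l : ℝ) := by
          rw [hIcc, Finset.mul_sum]
      _ ≤ max B 0 * max C₁ 0 * τ * L ^ k₁ * ((h * r : ℕ) : ℝ) * I₀ * (K * 2 ^ 25 * L ^ 225) :=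
          mul_le_mul_of_nonneg_left htauSum hcoef0
  -- the main part via `Step7u033` (exponent `k₁ + 225`, at `l = 1`)
  have hmain : ‖∑ l ∈ Finset.range (N + 1), g l‖ ≤
      max B 0 * max C₁ 0 * K * 2 ^ 25 * max C₃ 0 * τ * ((h * r : ℕ) : ℝ) * P ^ 2 *
        (D : ℝ) ^ (-min cT c₃) := by
    have h1 : L ^ (k₁ + 225) * ((h * r : ℕ) : ℝ) * I₀ ≤
        max C₃ 0 * ((h * r : ℕ) : ℝ) * P ^ 2 * (D : ℝ) ^ (-c₃) :=
      H33.trans (mul_le_mul_of_nonneg_right (mul_le_mul_of_nonneg_right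
        (mul_le_mul_of_nonneg_right (le_max_left _ _) (by positivity)) (by positivity))
        (Real.rpow_nonneg hD0.le _))
    have h2 : (D : ℝ) ^ (-c₃) ≤ (D : ℝ) ^ (-min cT c₃) :=
      Real.rpow_le_rpow_of_exponent_le hD1 (neg_le_neg (min_le_right _ _))
    calc ‖∑ l ∈ Finset.range (N + 1), g l‖
        ≤ max B 0 * max C₁ 0 * τ * L ^ k₁ * ((h * r : ℕ) : ℝ) * I₀ * (K * 2 ^ 25 * L ^ 225) :=
          hsum_g
      _ = max B 0 * max C₁ 0 * K * 2 ^ 25 * τ * (L ^ (k₁ + 225) * ((h * r : ℕ) : ℝ) * I₀) := by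
          rw [pow_add]; ring
      _ ≤ max B 0 * max C₁ 0 * K * 2 ^ 25 * τ *
            (max C₃ 0 * ((h * r : ℕ) : ℝ) * P ^ 2 * (D : ℝ) ^ (-c₃)) :=
          mul_le_mul_of_nonneg_left h1 (by positivity)
      _ ≤ max B 0 * max C₁ 0 * K * 2 ^ 25 * τ *
            (max C₃ 0 * ((h * r : ℕ) : ℝ) * P ^ 2 * (D : ℝ) ^ (-min cT c₃)) :=
          mul_le_mul_of_nonneg_left (mul_le_mul_of_nonneg_left h2 (by positivity)) (by positivity)
      _ = _ := by ring
  -- the tail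
  have htail_le :
      ‖tail7P2 c' D a₁ r h d θ‖ ≤ τ * ((h * r : ℕ) : ℝ) * P ^ 2 * (D : ℝ) ^ (-min cT c₃) := by
    have h1 : Real.exp (-cT * L ^ 10) ≤ (D : ℝ) ^ (-cT) := by
      have hL10 : L ≤ L ^ 10 := le_self_pow₀ hL1 (by norm_num)
      have h3 : Real.exp (-cT * L) = (D : ℝ) ^ (-cT) := by
        rw [Real.rpow_def_of_pos hD0, hlogD]; ring_nf
      calc Real.exp (-cT * L ^ 10) ≤ Real.exp (-cT * L) := Real.exp_le_exp.2 (by nlinarith)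
        _ = (D : ℝ) ^ (-cT) := h3
    have h2 : (D : ℝ) ^ (-cT) ≤ (D : ℝ) ^ (-min cT c₃) :=
      Real.rpow_le_rpow_of_exponent_le hD1 (neg_le_neg (min_le_left _ _))
    calc ‖tail7P2 c' D a₁ r h d θ‖ ≤ Real.exp (-cT * L ^ 10) := HT
      _ ≤ (D : ℝ) ^ (-min cT c₃) := h1.trans h2
      _ = 1 * 1 * 1 * (D : ℝ) ^ (-min cT c₃) := by ring
      _ ≤ τ * ((h * r : ℕ) : ℝ) * P ^ 2 * (D : ℝ) ^ (-min cT c₃) := by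
          gcongr
          exact one_le_pow₀ hP1
  -- conclusion
  calc ‖frakS c' D a₁ r h d θ‖
      = ‖∑ l ∈ Finset.range (N + 1), g l + tail7P2 c' D a₁ r h d θ‖ := by rw [hsplit]
    _ ≤ ‖∑ l ∈ Finset.range (N + 1), g l‖ + ‖tail7P2 c' D a₁ r h d θ‖ := norm_add_le _ _
    _ ≤ max B 0 * max C₁ 0 * K * 2 ^ 25 * max C₃ 0 * τ * ((h * r : ℕ) : ℝ) * P ^ 2 *
          (D : ℝ) ^ (-min cT c₃) + τ * ((h * r : ℕ) : ℝ) * P ^ 2 * (D : ℝ) ^ (-min cT c₃) :=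
        add_le_add hmain htail_le
    _ = (max B 0 * max C₁ 0 * K * 2 ^ 25 * max C₃ 0 + 1) * τ * ((h * r : ℕ) : ℝ) * P ^ 2 *
          (D : ℝ) ^ (-min cT c₃) := by ring

end Literature.NumberTheory.LFunctions.Zhang2022.Section7cStatements
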